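import Mathlib.Analysis.InnerProductSpace.Calculus
import Mathlib.Analysis.Calculus.FDeriv.WithLp
import Mathlib.Analysis.Calculus.Deriv.Inv
import Mathlib.Analysis.Calculus.Deriv.Pow
import Mathlib.Analysis.SpecialFunctions.Sqrt
import Mathlib.MeasureTheory.Measure.Haar.InnerProductSpace
import Mathlib.MeasureTheory.Integral.Bochner.Set
import Literature.Analysis.FluidPDE.SverakLandauClassification
import HarnessLib

/-!
# Route LandauJetArena (AnomalousDissipation) — shell dissipation of the Landau field is `≳ 1/(c−1)²`

Helper file for item stmt-AnomalousDissipation-1548 (`LandauOverDissipation`, support of route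
`LandauJetArena`). For Karch–Pilarczyk's Landau field `v_c = landauAxisField e₁ c` (axis `e₁`, `ν = 1`,
Karch–Pilarczyk 2011 (2.1)) we prove the DISSIPATION HALF of the item:

* `hasDerivAt_landauAxisField_line_zero`, `fderiv_landauAxisField_single_one_apply_zero` — the gradient
  entry `∂₂v¹(x) = −2c x₂((c−1)|x|(|x|²+3x₁²) + (|x|−x₁)³)/(|x|³(c|x|−x₁)³)` in closed form (differentiate
  along the line `t ↦ x + t e₂`; `HasDerivAt.norm_sq`, `hasFDerivWithinAt_piLp`, uniqueness);
* `sq_entry_ge_on_box` — on the Cartesian box `x₁ ∈ [6/5,3/2]`, `x₂ ∈ [√ε/2,√ε]`, `x₃ ∈ [0,√ε/2]`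
  (`ε = c−1`, polar angle `≍ √ε`, inside the shell) `(∂₂v¹)² ≥ 1/(2916 ε³)`;
* `integrableOn_frobeniusNormSq_shell` — `|∇v_c|²_F` is integrable on the shell (continuous on the compact
  closed shell off the origin, `contDiffOn_landauAxisField`; cf. `continuous_frobeniusNormSq'` in
  `CKNInterpolationEstimate.lean`, not imported to keep this file light);
* `shell_gradient_ge` — `∫_{1<|x|<2} |∇v_c|²_F ≥ (box volume `3ε/40`) · 1/(2916ε³) = 1/(38880 (c−1)²)`.

Constants are deliberately crude (the true value is `≈ 6.4π/(c−1)²`). Elementary real analysis. [folklore]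
-/

-- every `Summits/AnomalousDissipation/AnomalousDissipation/Theorems` file repeats the sub-problem name
set_option linter.dupNamespace false

noncomputable section

namespace Summit.AnomalousDissipation.AnomalousDissipation.Theorems.LandauOverDissipation

open MeasureTheory Real Set WithLp
open Literature.Analysis.FluidPDE
open scoped InnerProductSpace RealInnerProductSpace


/-- The straight line `t ↦ x + t e₂` has velocity `e₂`. [folklore] -/
theorem hasDerivAt_line (x : EuclideanSpace ℝ (Fin 3)) :
    HasDerivAt (fun t : ℝ => x + t • EuclideanSpace.single (1 : Fin 3) (1 : ℝ))
      (EuclideanSpace.single (1 : Fin 3) (1 : ℝ)) 0 := by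
  simpa using ((hasDerivAt_id (0 : ℝ)).smul_const (EuclideanSpace.single (1 : Fin 3) (1 : ℝ))).const_add x

/-- Derivative of the distance to the origin along the line `t ↦ x + t e₂` at `t = 0`: `x₂/|x|`. [folklore] -/
theorem hasDerivAt_norm_line {x : EuclideanSpace ℝ (Fin 3)} (hx : x ≠ 0) :
    HasDerivAt (fun t : ℝ => ‖x + t • EuclideanSpace.single (1 : Fin 3) (1 : ℝ)‖) (x 1 / ‖x‖) 0 := by
  have h1 := (hasDerivAt_line x).norm_sq
  simp only [zero_smul, add_zero] at h1
  have h2 : ⟪x, EuclideanSpace.single (1 : Fin 3) (1 : ℝ)⟫ = x 1 := by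
    rw [EuclideanSpace.inner_single_right]; simp
  rw [h2] at h1
  have hx2 : ‖x + (0 : ℝ) • EuclideanSpace.single (1 : Fin 3) (1 : ℝ)‖ ^ 2 ≠ 0 := by
    simpa using hx
  have h3 := h1.sqrt hx2
  have h4 : (fun t : ℝ => √(‖x + t • EuclideanSpace.single (1 : Fin 3) (1 : ℝ)‖ ^ 2)) =
      fun t => ‖x + t • EuclideanSpace.single (1 : Fin 3) (1 : ℝ)‖ := by
    funext t; exact Real.sqrt_sq (norm_nonneg _)
  rw [h4] at h3
  simp only [zero_smul, add_zero, Real.sqrt_sq (norm_nonneg _)] at h3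
  convert h3 using 1
  have : ‖x‖ ≠ 0 := norm_ne_zero_iff.2 hx
  field_simp

/-- The axial component of Karch–Pilarczyk's field along the line `t ↦ x + t e₂` (for `x₁ ≠ 0`, so the
line misses the origin): `v¹(x + t e₂) = 2(cR² − 2x₁R + cx₁²)/(R(cR − x₁)²)`, `R = |x + t e₂|`. [folklore] -/
theorem landauAxisField_line_apply_zero {c : ℝ} (hc : 1 < |c|) {x : EuclideanSpace ℝ (Fin 3)}
    (hx0 : x 0 ≠ 0) (t : ℝ) :
    landauAxisField (EuclideanSpace.single 0 1) c (x + t • EuclideanSpace.single (1 : Fin 3) (1 : ℝ)) 0 =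
      2 * (c * ‖x + t • EuclideanSpace.single (1 : Fin 3) (1 : ℝ)‖ ^ 2
          - 2 * x 0 * ‖x + t • EuclideanSpace.single (1 : Fin 3) (1 : ℝ)‖ + c * x 0 ^ 2) /
        (‖x + t • EuclideanSpace.single (1 : Fin 3) (1 : ℝ)‖
          * (c * ‖x + t • EuclideanSpace.single (1 : Fin 3) (1 : ℝ)‖ - x 0) ^ 2) := by
  have hne : x + t • EuclideanSpace.single (1 : Fin 3) (1 : ℝ) ≠ 0 := by
    intro h
    have := congrArg (fun v : EuclideanSpace ℝ (Fin 3) => v 0) h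
    simp at this
    exact hx0 this
  rw [landauAxisField_single_zero hc hne]
  simp

/-- The closed form of `∂₂ v¹` (derivative of the axial component in the transverse direction `e₂`):
`∂₂v¹(x) = −2c x₂ ((c−1)|x|(|x|²+3x₁²) + (|x|−x₁)³)/(|x|³ (c|x|−x₁)³)` for `1 < c`, `x₁ ≠ 0`
(elementary differentiation of Karch–Pilarczyk's (2.1)). [folklore] -/
theorem hasDerivAt_landauAxisField_line_zero {c : ℝ} (hc : 1 < c) {x : EuclideanSpace ℝ (Fin 3)}
    (hx0 : x 0 ≠ 0) :
    HasDerivAt (fun t : ℝ =>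
        landauAxisField (EuclideanSpace.single 0 1) c (x + t • EuclideanSpace.single (1 : Fin 3) (1 : ℝ)) 0)
      (-(2 * c * x 1 * ((c - 1) * ‖x‖ * (‖x‖ ^ 2 + 3 * x 0 ^ 2) + (‖x‖ - x 0) ^ 3)) /
        (‖x‖ ^ 3 * (c * ‖x‖ - x 0) ^ 3)) 0 := by
  have hc' : 1 < |c| := by rwa [abs_of_pos (by linarith)]
  have hx : x ≠ 0 := by
    intro h; apply hx0; simp [h]
  have hr : ‖x‖ ≠ 0 := norm_ne_zero_iff.2 hx
  have hr0 : 0 < ‖x‖ := norm_pos_iff.2 hx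
  have hax : x 0 ≤ ‖x‖ := by
    have h3 : x 0 ^ 2 ≤ ‖x‖ ^ 2 := by
      rw [EuclideanSpace.real_norm_sq_eq, Fin.sum_univ_three]
      nlinarith [sq_nonneg (x 1), sq_nonneg (x 2)]
    exact abs_le_of_sq_le_sq' h3 (norm_nonneg _) |>.2
  have hq : c * ‖x‖ - x 0 ≠ 0 := by nlinarith
  have hfun : (fun t : ℝ =>
        landauAxisField (EuclideanSpace.single 0 1) c (x + t • EuclideanSpace.single (1 : Fin 3) (1 : ℝ)) 0) =
      fun t => 2 * (c * ‖x + t • EuclideanSpace.single (1 : Fin 3) (1 : ℝ)‖ ^ 2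
          - 2 * x 0 * ‖x + t • EuclideanSpace.single (1 : Fin 3) (1 : ℝ)‖ + c * x 0 ^ 2) /
        (‖x + t • EuclideanSpace.single (1 : Fin 3) (1 : ℝ)‖
          * (c * ‖x + t • EuclideanSpace.single (1 : Fin 3) (1 : ℝ)‖ - x 0) ^ 2) := by
    funext t; exact landauAxisField_line_apply_zero hc' hx0 t
  rw [hfun]
  have hR := hasDerivAt_norm_line hx
  have hnum := (((hR.fun_pow 2).const_mul c).fun_sub (hR.const_mul (2 * x 0))).add_const (c * x 0 ^ 2)
  have hden := hR.fun_mul (((hR.const_mul c).sub_const (x 0)).fun_pow 2)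
  have hden0 : ‖x + (0 : ℝ) • EuclideanSpace.single (1 : Fin 3) (1 : ℝ)‖
      * (c * ‖x + (0 : ℝ) • EuclideanSpace.single (1 : Fin 3) (1 : ℝ)‖ - x 0) ^ 2 ≠ 0 := by
    simp only [zero_smul, add_zero]
    exact mul_ne_zero hr (pow_ne_zero 2 hq)
  have h := (hnum.const_mul 2).fun_div hden hden0
  simp only [zero_smul, add_zero, Nat.cast_ofNat, show (2 : ℕ) - 1 = 1 from rfl, pow_one] at h
  refine h.congr_deriv ?_
  field_simp
  ring


/-- The Landau field with axis `e₁` is differentiable off the origin (`|c| > 1`). [folklore] -/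
theorem differentiableAt_landauAxisField {c : ℝ} (hc : 1 < |c|) {x : EuclideanSpace ℝ (Fin 3)}
    (hx : x ≠ 0) :
    DifferentiableAt ℝ (landauAxisField (EuclideanSpace.single 0 1) c) x := by
  have ha : ‖(EuclideanSpace.single 0 1 : EuclideanSpace ℝ (Fin 3))‖ = 1 := by simp
  have h := (contDiffOn_landauAxisField (n := 1) ha hc).differentiableOn one_ne_zero
  exact h.differentiableAt (isOpen_ne.mem_nhds hx)

/-- The `(0,1)` entry of the velocity gradient (`∂₂v¹`, Lean indices `(L e₁) 0` with `e₁ = single 1 1`)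
of Karch–Pilarczyk's field in closed form, for `1 < c` and `x₁ ≠ 0`. [folklore] -/
theorem fderiv_landauAxisField_single_one_apply_zero {c : ℝ} (hc : 1 < c)
    {x : EuclideanSpace ℝ (Fin 3)} (hx0 : x 0 ≠ 0) :
    fderiv ℝ (landauAxisField (EuclideanSpace.single 0 1) c) x (EuclideanSpace.single (1 : Fin 3) (1 : ℝ)) 0 =
      -(2 * c * x 1 * ((c - 1) * ‖x‖ * (‖x‖ ^ 2 + 3 * x 0 ^ 2) + (‖x‖ - x 0) ^ 3)) /
        (‖x‖ ^ 3 * (c * ‖x‖ - x 0) ^ 3) := by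
  have hc' : 1 < |c| := by rwa [abs_of_pos (by linarith)]
  have hx : x ≠ 0 := by
    intro h; apply hx0; simp [h]
  set L := fderiv ℝ (landauAxisField (EuclideanSpace.single 0 1) c) x with hL_def
  have hL : HasFDerivAt (landauAxisField (EuclideanSpace.single 0 1) c) L x :=
    (differentiableAt_landauAxisField hc' hx).hasFDerivAt
  have h0 : HasFDerivAt (fun y => landauAxisField (EuclideanSpace.single 0 1) c y 0)
      (PiLp.proj 2 (fun _ : Fin 3 => ℝ) 0 ∘L L) x :=
    ((hasFDerivWithinAt_piLp 2).1 (hL.hasFDerivWithinAt (s := Set.univ)) 0).hasFDerivAt_of_univ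
  have hcomp := h0.comp_hasDerivAt_of_eq 0 (hasDerivAt_line x) (by simp)
  have hcomp' : HasDerivAt (fun t : ℝ =>
        landauAxisField (EuclideanSpace.single 0 1) c (x + t • EuclideanSpace.single (1 : Fin 3) (1 : ℝ)) 0)
      (L (EuclideanSpace.single (1 : Fin 3) (1 : ℝ)) 0) 0 := by
    simpa [Function.comp_def] using hcomp
  exact hcomp'.unique (hasDerivAt_landauAxisField_line_zero hc hx0)

/-- One squared entry is dominated by the Frobenius norm: `((L e₂)₁)² ≤ |L|²_F`. [folklore] -/
theorem sq_apply_le_frobeniusNormSq (L : EuclideanSpace ℝ (Fin 3) →L[ℝ] EuclideanSpace ℝ (Fin 3)) :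
    (L (EuclideanSpace.single (1 : Fin 3) (1 : ℝ)) 0) ^ 2 ≤ frobeniusNormSq L := by
  rw [frobeniusNormSq_eq_sum (EuclideanSpace.basisFun (Fin 3) ℝ)]
  calc (L (EuclideanSpace.single (1 : Fin 3) (1 : ℝ)) 0) ^ 2
        ≤ ‖L (EuclideanSpace.single (1 : Fin 3) (1 : ℝ))‖ ^ 2 := by
        rw [EuclideanSpace.real_norm_sq_eq, Fin.sum_univ_three]
        nlinarith [sq_nonneg (L (EuclideanSpace.single (1 : Fin 3) (1 : ℝ)) 1),
          sq_nonneg (L (EuclideanSpace.single (1 : Fin 3) (1 : ℝ)) 2)]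
    _ = ‖L (EuclideanSpace.basisFun (Fin 3) ℝ 1)‖ ^ 2 := by simp
    _ ≤ ∑ i, ‖L (EuclideanSpace.basisFun (Fin 3) ℝ i)‖ ^ 2 :=
        Finset.single_le_sum (f := fun i => ‖L (EuclideanSpace.basisFun (Fin 3) ℝ i)‖ ^ 2)
          (fun i _ => sq_nonneg _) (Finset.mem_univ (1 : Fin 3))

/-- Pointwise algebra behind the dissipation floor: on the box `x₁ ∈ [6/5,3/2]`, `x₂ ∈ [s/2, s]`,
`x₃ ∈ [0, s/2]` (`s² = c − 1`, `1 < c < 2`), the closed form of `∂₂v¹` has square `≥ 1/(2916 (c−1)³)`. [folklore] -/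
theorem sq_entry_ge_on_box {c s r x0 x1 x2 : ℝ} (hc1 : 1 < c) (hc2 : c < 2) (hs : 0 < s)
    (hs2 : s ^ 2 = c - 1) (hr : 0 ≤ r) (hrel : r ^ 2 = x0 ^ 2 + x1 ^ 2 + x2 ^ 2)
    (h0a : 6 / 5 ≤ x0) (h0b : x0 ≤ 3 / 2) (h1a : s / 2 ≤ x1) (h1b : x1 ≤ s)
    (h2a : 0 ≤ x2) (h2b : x2 ≤ s / 2) :
    1 / (2916 * (c - 1) ^ 3) ≤
      (-(2 * c * x1 * ((c - 1) * r * (r ^ 2 + 3 * x0 ^ 2) + (r - x0) ^ 3)) / (r ^ 3 * (c * r - x0) ^ 3)) ^ 2 := by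
  have hε : 0 < c - 1 := by linarith
  have hx1 : 0 ≤ x1 := by linarith
  have hx1sq : x1 ^ 2 ≤ c - 1 := by rw [← hs2]; exact pow_le_pow_left₀ hx1 h1b 2
  have hx2sq : x2 ^ 2 ≤ (c - 1) / 4 := by
    have := pow_le_pow_left₀ h2a h2b 2
    rw [div_pow, hs2] at this
    linarith
  have hr_ge : x0 ≤ r := by nlinarith [sq_nonneg x1, sq_nonneg x2]
  have hr1 : 1 ≤ r := by linarith
  have hr2 : r ≤ 2 := by nlinarith
  have hprod : (r - x0) * (r + x0) ≤ 5 / 4 * (c - 1) := by nlinarith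
  have hrx0 : r - x0 ≤ c - 1 := by
    nlinarith [mul_le_mul_of_nonneg_left (show 12 / 5 ≤ r + x0 by linarith) (show 0 ≤ r - x0 by linarith)]
  have hqeq : c * r - x0 = (c - 1) * r + (r - x0) := by ring
  have hq0 : 0 < c * r - x0 := by
    rw [hqeq]; nlinarith [mul_pos hε (show (0 : ℝ) < r by linarith)]
  have hq : c * r - x0 ≤ 3 * (c - 1) := by
    rw [hqeq]; nlinarith [mul_le_mul_of_nonneg_left hr2 hε.le]
  have hM0 : 0 < r ^ 3 * (c * r - x0) ^ 3 := by positivity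
  have hM : r ^ 3 * (c * r - x0) ^ 3 ≤ 216 * (c - 1) ^ 3 := by
    have h3 : r ^ 3 ≤ 2 ^ 3 := pow_le_pow_left₀ hr hr2 3
    have h4 : (c * r - x0) ^ 3 ≤ (3 * (c - 1)) ^ 3 := pow_le_pow_left₀ hq0.le hq 3
    calc r ^ 3 * (c * r - x0) ^ 3 ≤ 2 ^ 3 * (3 * (c - 1)) ^ 3 :=
          mul_le_mul h3 h4 (by positivity) (by norm_num)
      _ = 216 * (c - 1) ^ 3 := by ring
  have hN : 4 * (c - 1) * s ≤ 2 * c * x1 * ((c - 1) * r * (r ^ 2 + 3 * x0 ^ 2) + (r - x0) ^ 3) := by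
    have h5a : 4 ≤ r ^ 2 + 3 * x0 ^ 2 := by nlinarith
    have h5 : 4 ≤ r * (r ^ 2 + 3 * x0 ^ 2) := by
      calc (4 : ℝ) = 1 * 4 := by norm_num
        _ ≤ r * (r ^ 2 + 3 * x0 ^ 2) := mul_le_mul hr1 h5a (by norm_num) hr
    have h6 : 0 ≤ (r - x0) ^ 3 := pow_nonneg (by linarith) 3
    have h7 : 4 * (c - 1) ≤ (c - 1) * r * (r ^ 2 + 3 * x0 ^ 2) + (r - x0) ^ 3 := by
      have := mul_le_mul_of_nonneg_left h5 hε.le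
      nlinarith
    have h8 : s ≤ 2 * c * x1 := by nlinarith [mul_le_mul_of_nonneg_right hc1.le hx1]
    calc 4 * (c - 1) * s = s * (4 * (c - 1)) := by ring
      _ ≤ (2 * c * x1) * ((c - 1) * r * (r ^ 2 + 3 * x0 ^ 2) + (r - x0) ^ 3) :=
          mul_le_mul h8 h7 (by positivity) (by positivity)
  rw [neg_div, neg_sq, div_pow, div_le_div_iff₀ (by positivity) (by positivity), one_mul]
  have h9 := pow_le_pow_left₀ hM0.le hM 2
  have h10 := pow_le_pow_left₀ (by positivity) hN 2
  have h11 : (4 * (c - 1) * s) ^ 2 = 16 * (c - 1) ^ 3 := by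
    rw [mul_pow, hs2]; ring
  rw [h11] at h10
  have h12 := mul_le_mul_of_nonneg_right h10 (show 0 ≤ 2916 * (c - 1) ^ 3 by positivity)
  nlinarith [h9, h12]

/-- The dissipation density `|∇v_c|²_F` of the Landau field is integrable on the shell `1 < |x| < 2`
(it is continuous on the compact closed shell, which misses the origin). [folklore] -/
theorem integrableOn_frobeniusNormSq_shell {c : ℝ} (hc : 1 < |c|) :
    IntegrableOn (fun x => frobeniusNormSq (fderiv ℝ (landauAxisField (EuclideanSpace.single 0 1) c) x))
      {x : EuclideanSpace ℝ (Fin 3) | 1 < ‖x‖ ∧ ‖x‖ < 2} := by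
  have ha : ‖(EuclideanSpace.single 0 1 : EuclideanSpace ℝ (Fin 3))‖ = 1 := by simp
  have hcont : ContinuousOn (fderiv ℝ (landauAxisField (EuclideanSpace.single 0 1) c))
      {x : EuclideanSpace ℝ (Fin 3) | x ≠ 0} :=
    (contDiffOn_landauAxisField (n := 1) ha hc).continuousOn_fderiv_of_isOpen isOpen_ne le_rfl
  have hK : IsCompact {x : EuclideanSpace ℝ (Fin 3) | 1 ≤ ‖x‖ ∧ ‖x‖ ≤ 2} :=
    (isCompact_closedBall (0 : EuclideanSpace ℝ (Fin 3)) 2).of_isClosed_subset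
      ((isClosed_le continuous_const continuous_norm).inter
        (isClosed_le continuous_norm continuous_const))
      fun x hx => mem_closedBall_zero_iff.2 hx.2
  have hKsub :
      {x : EuclideanSpace ℝ (Fin 3) | 1 ≤ ‖x‖ ∧ ‖x‖ ≤ 2} ⊆ {x : EuclideanSpace ℝ (Fin 3) | x ≠ 0} := by
    intro x hx h0
    rw [Set.mem_setOf_eq, h0, norm_zero] at hx
    linarith [hx.1]
  have hfrob : Continuous
      fun L : EuclideanSpace ℝ (Fin 3) →L[ℝ] EuclideanSpace ℝ (Fin 3) => frobeniusNormSq L := by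
    have : (fun L : EuclideanSpace ℝ (Fin 3) →L[ℝ] EuclideanSpace ℝ (Fin 3) => frobeniusNormSq L) =
        fun L => ∑ i, ‖L (EuclideanSpace.basisFun (Fin 3) ℝ i)‖ ^ 2 := by
      funext L; exact frobeniusNormSq_eq_sum _ L
    rw [this]
    exact continuous_finsetSum _ fun i _ => ((continuous_eval_const _).norm).pow 2
  have hF : ContinuousOn
      (fun x => frobeniusNormSq (fderiv ℝ (landauAxisField (EuclideanSpace.single 0 1) c) x))
      {x : EuclideanSpace ℝ (Fin 3) | 1 ≤ ‖x‖ ∧ ‖x‖ ≤ 2} :=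
    (hfrob.comp_continuousOn hcont).mono hKsub
  exact (hF.integrableOn_compact hK).mono_set fun x hx => ⟨hx.1.le, hx.2.le⟩

/-- **Shell dissipation of the Landau field.** For `1 < c < 2`,
`∫_{1<|x|<2} |∇v_c(x)|²_F dx ≥ 1/(38880 (c − 1)²)` (Karch–Pilarczyk's `v_c`, axis `e₁`, `ν = 1`):
the entry `∂₂v¹` alone has size `≳ (c−1)^{-3/2}` on a Cartesian box of volume `3(c−1)/40` at polar
angle `≍ (c−1)^{1/2}` inside the shell. [folklore] -/
theorem shell_gradient_ge {c : ℝ} (hc1 : 1 < c) (hc2 : c < 2) :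
    1 / (38880 * (c - 1) ^ 2) ≤ ∫ x in {x : EuclideanSpace ℝ (Fin 3) | 1 < ‖x‖ ∧ ‖x‖ < 2},
      frobeniusNormSq (fderiv ℝ (landauAxisField (EuclideanSpace.single 0 1) c) x) := by
  have hc' : 1 < |c| := by rwa [abs_of_pos (by linarith)]
  have hε : 0 < c - 1 := by linarith
  set s := √(c - 1) with hs_def
  have hs : 0 < s := Real.sqrt_pos.2 hε
  have hs2 : s ^ 2 = c - 1 := Real.sq_sqrt hε.le
  set l : Fin 3 → ℝ := ![6 / 5, s / 2, 0] with hl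
  set u : Fin 3 → ℝ := ![3 / 2, s, s / 2] with hu
  have hlu : l ≤ u := by
    intro i
    fin_cases i <;> simp [hl, hu] <;> linarith
  set R : Set (EuclideanSpace ℝ (Fin 3)) := (@ofLp 2 (Fin 3 → ℝ)) ⁻¹' Icc l u with hR
  have hmp := PiLp.volume_preserving_ofLp (Fin 3)
  have hRmeas : MeasurableSet R := measurableSet_Icc.preimage hmp.measurable
  have hvol : volume.real R = 3 / 40 * (c - 1) := by
    rw [measureReal_def, hR, hmp.measure_preimage measurableSet_Icc.nullMeasurableSet,
      Real.volume_Icc_pi_toReal hlu, Fin.prod_univ_three]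
    simp only [hl, hu, Matrix.cons_val_zero, Matrix.cons_val_one, Matrix.cons_val_two, Matrix.head_cons,
      Matrix.tail_cons]
    rw [← hs2]; ring
  have hmem : ∀ x ∈ R,
      (6 / 5 ≤ x 0 ∧ x 0 ≤ 3 / 2) ∧ (s / 2 ≤ x 1 ∧ x 1 ≤ s) ∧ (0 ≤ x 2 ∧ x 2 ≤ s / 2) := by
    intro x hx
    obtain ⟨hxl, hxu⟩ := hx
    have h0 := hxl 0; have h1 := hxl 1; have h2 := hxl 2
    have h0' := hxu 0; have h1' := hxu 1; have h2' := hxu 2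
    simp only [hl, hu, Matrix.cons_val_zero, Matrix.cons_val_one, Matrix.cons_val_two, Matrix.head_cons,
      Matrix.tail_cons] at h0 h1 h2 h0' h1' h2'
    exact ⟨⟨h0, h0'⟩, ⟨h1, h1'⟩, ⟨h2, h2'⟩⟩
  have hnsq : ∀ x : EuclideanSpace ℝ (Fin 3), ‖x‖ ^ 2 = x 0 ^ 2 + x 1 ^ 2 + x 2 ^ 2 :=
      fun x => by
    rw [EuclideanSpace.real_norm_sq_eq, Fin.sum_univ_three]
  have hRA : R ⊆ {x : EuclideanSpace ℝ (Fin 3) | 1 < ‖x‖ ∧ ‖x‖ < 2} := by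
    intro x hx
    obtain ⟨⟨h0a, h0b⟩, ⟨h1a, h1b⟩, ⟨h2a, h2b⟩⟩ := hmem x hx
    have hn := hnsq x
    have hx1sq : x 1 ^ 2 ≤ c - 1 := by rw [← hs2]; exact pow_le_pow_left₀ (by linarith) h1b 2
    have hx2sq : x 2 ^ 2 ≤ (c - 1) / 4 := by
      have := pow_le_pow_left₀ h2a h2b 2
      rw [div_pow, hs2] at this
      linarith
    have hnn := norm_nonneg x
    constructor
    · nlinarith [sq_nonneg (x 1), sq_nonneg (x 2)]
    · nlinarith
  have hpt : ∀ x ∈ R, 1 / (2916 * (c - 1) ^ 3) ≤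
      frobeniusNormSq (fderiv ℝ (landauAxisField (EuclideanSpace.single 0 1) c) x) := by
    intro x hx
    obtain ⟨⟨h0a, h0b⟩, ⟨h1a, h1b⟩, ⟨h2a, h2b⟩⟩ := hmem x hx
    have hx0 : x 0 ≠ 0 := by
      intro h; rw [h] at h0a; linarith
    calc 1 / (2916 * (c - 1) ^ 3)
        ≤ (-(2 * c * x 1 * ((c - 1) * ‖x‖ * (‖x‖ ^ 2 + 3 * x 0 ^ 2) + (‖x‖ - x 0) ^ 3)) /
            (‖x‖ ^ 3 * (c * ‖x‖ - x 0) ^ 3)) ^ 2 :=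
          sq_entry_ge_on_box hc1 hc2 hs hs2 (norm_nonneg x) (hnsq x) h0a h0b h1a h1b h2a h2b
      _ = (fderiv ℝ (landauAxisField (EuclideanSpace.single 0 1) c) x
            (EuclideanSpace.single (1 : Fin 3) (1 : ℝ)) 0) ^ 2 := by
          rw [fderiv_landauAxisField_single_one_apply_zero hc1 hx0]
      _ ≤ _ := sq_apply_le_frobeniusNormSq _
  have hFint := integrableOn_frobeniusNormSq_shell hc'
  have hRfin : volume R ≠ ⊤ := by
    have h1 : R ⊆ Metric.closedBall (0 : EuclideanSpace ℝ (Fin 3)) 2 := fun x hx =>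
      mem_closedBall_zero_iff.2 (hRA hx).2.le
    exact ((measure_mono h1).trans_lt measure_closedBall_lt_top).ne
  calc 1 / (38880 * (c - 1) ^ 2) = volume.real R * (1 / (2916 * (c - 1) ^ 3)) := by
        rw [hvol]; field_simp; ring
    _ = ∫ x in R, (1 / (2916 * (c - 1) ^ 3) : ℝ) := by
        rw [setIntegral_const, smul_eq_mul]
    _ ≤ ∫ x in R, frobeniusNormSq (fderiv ℝ (landauAxisField (EuclideanSpace.single 0 1) c) x) :=
        setIntegral_mono_on (integrableOn_const hRfin) (hFint.mono_set hRA) hRmeas hpt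
    _ ≤ ∫ x in {x : EuclideanSpace ℝ (Fin 3) | 1 < ‖x‖ ∧ ‖x‖ < 2},
          frobeniusNormSq (fderiv ℝ (landauAxisField (EuclideanSpace.single 0 1) c) x) :=
        setIntegral_mono_set hFint (Filter.Eventually.of_forall fun x => frobeniusNormSq_nonneg _)
          hRA.eventuallyLE

end Summit.AnomalousDissipation.AnomalousDissipation.Theorems.LandauOverDissipation
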